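import Summits.Ventures.CertifiedManyBodySolver.Cruxes.ThermalStiffnessCeilingU8b10_le_1o8.Disproof
import HarnessLib

/-!
# BN-resc-1 — the divergence hypothesis of K1 is decidable NON-JUNK at `L = 3` (one certified 3×3 torus computation)

Planner `hubbard-floor-idea-rescuer` g2 (lens = rescuer; zero kit). By-product of CENSUS-idea-rescuer-r3, filed on the crux dir of
K1 = `TcThermcert1.ThermalStiffnessCeilingU8b10_le_1o8` (stmt-Ventures-26381). HONEST FRAMING: bookkeeping about which hypothesis of a
one-sided CEILING statement is load-bearing; nothing about superconductivity in the Hubbard model is proved or disproved here; no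
number below is a cell of record; the only numerical inputs quoted are FLOATS of other seats, labelled as such.

WHAT THIS ADDS TO `Disproof.lean` (v4, 41b6a8120c0a6237). There, `K1WithoutTendsto` (divergence dropped) is refuted by a JUNK witness
(`Ls ≡ 0`, `k1_false_without_tendsto_junk`) and the honest variant `K1WithoutTendstoPos` (all sizes positive, no divergence) is recorded
as «expected false (small even tori), not kernel-decidable today … needs a certified finite-L flux free-energy curvature at β·t = 10
exceeding 1/8», with the HANDOFF naming `L = 4` (sector (7,7), dimension 11440², FTLM = float only) as the next regime.

Two remarks make this decidable NOW, by one small certified job: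
* (i)  `L = 4` is the WRONG size: the 4×4 flux cost at `(U, β·t) = (8, 10)` is NEGATIVE (`R_4(8) = g_4(0.1)/0.1 = −0.221 ± 0.030`,
       eng-5 FTLM float, K2 `Disproof.lean` (b′)) — a paramagnetic size satisfies NO premise with `ρs > 0` (`premise_false_of_nonpos`
       below), so it can never witness `¬ K1WithoutTendstoPos`; and `L = 2` is gauge-trivial (`g_2 ≡ 0`, same source).
* (ii) `L = 3` is the RIGHT size and is EXACTLY diagonalisable: `N_3 = 2⌊(7/8)·9/2⌋ = 6`, sector `(3,3)` of the 9-site torus,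
       dimension `C(9,3)² = 7056` (≤ 784 per total-momentum block) — a full certified spectrum (ball arithmetic, or float `eigh` +
       a-posteriori residual enclosures) is a ≤ 2 core-h job, not an FTLM estimate. Float evidence that the certificate will come out
       TRUE: `R_3(8) = 0.2254` (hub-tc-therm-idea-4 g3, exact-ED float, K2 `Disproof.lean` (b′)), i.e. `g_3(θ) ≈ 2.25·θ²` near 0,
       against the threshold `10·(1/8)·θ² = 1.25·θ²` — an 80 % margin.
Hence the typed reduction `not_k1WithoutTendstoPos_of_floor`: ANY one positive size `L` with a certified quadratic floor
`a·θ² ≤ g_L(θ)` on some window, `a > 5/4`, refutes `K1WithoutTendstoPos`; instantiated at `L = 3` with the named certificate target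
`CertFluxCost3x3Floor` (a `Prop`, NOT claimed here). Reading once certified: the divergence hypothesis `Tendsto Ls atTop atTop` of K1 is
load-bearing for a NON-junk reason — the 3×3 torus at β·t = 10 is stiffer than 1/8 in K1's own normalisation — which is the standing
disprover's open (a)-item, closed.

CERTIFICATE SPEC (for an engineer seat if the lead commissions it; ZERO kit used by this seat). Object: `thermalFluxLogZ 3 0 8 (1/8) 10 θ =
Re log Tr_{(3,3)} exp(−10·H_3(θ))`, `H_3(θ) = hubbardTorusTT'Flux 3 0 8 θ` (total flux θ through the x-cycle; Z is gauge-invariant on the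
sector, so seam or uniform gauge may be used, but the 3-cycle has three distinct x-bonds per row — no simple-graph degeneracy as at L = 2).
Deliver: (1) certified enclosures of all 7056 eigenvalues at θ = 0 and of `g''(0) = β·[⟨H''(0)⟩ − β·(H'(0);H'(0))_Duhamel]` (uniform gauge:
`H' = J_x/3`, `H'' = −K_x/9`), expected `g''(0) ≈ 4.5`; (2) a crude analytic bound `|g''''| ≤ B` on `|θ| ≤ θ₀` from operator norms
(`‖∂^k H‖ ≤ ‖K_x‖/3^k`); (3) the window: `g(θ) ≥ ½ g''(0) θ² − (B/24) θ⁴ ≥ 2θ²` for `θ₀² ≤ 6(g''(0) − 4)/B`. Then `CertFluxCost3x3Floor`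
(with that θ₀ in place of 1/100 if smaller — restate the node, the reduction takes any θ₀ > 0) is a `cert_` node in the cell's grammar.
-/

noncomputable section

namespace Summit.Ventures.CertifiedManyBodySolver.Cruxes.ThermalStiffnessCeilingU8b10_le_1o8.TendstoDeciderL3

open Real Filter
open Summit.Ventures.CertifiedManyBodySolver.Observables
open Summit.Ventures.CertifiedManyBodySolver.Theses
open Summit.Ventures.CertifiedManyBodySolver.Cruxes.ThermalStiffnessCeilingU8b10_le_1o8.Disproof

/-- The K1 flux cost of the `L×L` torus at `(t′, U, 1−n, β·t) = (0, 8, 1/8, 10)`: `g_L(θ) = log Z_L(0) − log Z_L(θ)` on the sector. -/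
def fluxCost (L : ℕ) [NeZero L] (θ : ℝ) : ℝ :=
  thermalFluxLogZ L 0 8 (1 - 7 / 8) 10 0 - thermalFluxLogZ L 0 8 (1 - 7 / 8) 10 θ

/-- Certificate SHAPE: a quadratic floor `a·θ² ≤ g_L(θ)` on the window `|θ| ≤ θ₀` at ONE size `L`. -/
def FluxCostQuadFloorAt (L : ℕ) [NeZero L] (θ₀ a : ℝ) : Prop :=
  ∀ θ : ℝ, |θ| ≤ θ₀ → a * θ ^ 2 ≤ fluxCost L θ

/-- **The decider.** One positive size with a certified quadratic floor of slope `a > 5/4 = 10·(1/8)` refutes `K1WithoutTendstoPos`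
(take `ρs := a/10 > 1/8`, the constant sequence `Ls ≡ L`; `0 < L` comes from `NeZero L`). -/
theorem not_k1WithoutTendstoPos_of_floor {L : ℕ} [NeZero L] {θ₀ a : ℝ} (hθ₀ : 0 < θ₀) (ha : 5 / 4 < a)
    (h : FluxCostQuadFloorAt L θ₀ a) : ¬ K1WithoutTendstoPos := by
  intro hK
  have hL : 0 < L := Nat.pos_of_ne_zero (NeZero.ne L)
  have key := hK (a / 10) θ₀ (by linarith) hθ₀ (fun _ => L) (fun _ => hL) (fun j _ θ hθ => by
    have h1 := h θ hθ
    have h2 : 10 * (a / 10) * θ ^ 2 = a * θ ^ 2 := by ring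
    simpa only [fluxCost, h2] using h1)
  push_cast at key
  linarith

/-- A size at which the flux cost is non-positive at some `θ₁ ≠ 0` of the window carries NO premise with `ρs > 0` on that window
(so paramagnetic sizes — `L = 4` at `(8, β·t = 10)` by the eng-5 float — can never witness `¬ K1WithoutTendstoPos`, and are never
binding for K1 either). -/
theorem premise_false_of_nonpos {L : ℕ} [NeZero L] {θ₀ ρs θ₁ : ℝ} (hρ : 0 < ρs) (hθ₁ : |θ₁| ≤ θ₀) (hne : θ₁ ≠ 0)
    (hnonpos : fluxCost L θ₁ ≤ 0) :
    ¬ (∀ θ : ℝ, |θ| ≤ θ₀ → 10 * ρs * θ ^ 2 ≤ fluxCost L θ) := by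
  intro h
  have h1 := h θ₁ hθ₁
  have h2 : 0 < θ₁ ^ 2 := by positivity
  nlinarith

/-- CERTIFICATE TARGET (a `Prop`; NOT claimed, NOT a cell of record): the 3×3 torus (sector (3,3), β·t = 10, U = 8, t′ = 0) has flux cost
at least `2·θ²` on `|θ| ≤ 1/100`. Float evidence: `R_3(8) = 0.2254`, i.e. `g_3(θ) ≈ 2.25·θ²` (idea-4 g3 exact-ED float, K2 Disproof (b′)).
To be fed by ONE certified 3×3 ED job (spec in the module docstring); restate with the job's θ₀ if it comes out smaller. -/
def CertFluxCost3x3Floor : Prop := FluxCostQuadFloorAt 3 (1 / 100) 2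

/-- Instantiation: the 3×3 certificate decides the honest finite-size variant of K1 in the negative. -/
theorem not_k1WithoutTendstoPos_of_cert3 (h : CertFluxCost3x3Floor) : ¬ K1WithoutTendstoPos :=
  not_k1WithoutTendstoPos_of_floor (L := 3) (by norm_num) (by norm_num) h

/-- Converse bookkeeping: the JUNK-free variant is all that separates the junk refutation from K1 —
`K1WithoutTendsto → K1WithoutTendstoPos` (Disproof) and `K1WithoutTendsto → K1` (Disproof); with the certificate, the middle term is
false while K1 stays open: the divergence hypothesis is load-bearing for a non-junk reason. -/
theorem chain_readback :
    (K1WithoutTendsto → K1WithoutTendstoPos) ∧ (K1WithoutTendsto → TcThermcert1.ThermalStiffnessCeilingU8b10_le_1o8) :=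
  ⟨withoutTendstoPos_of_withoutTendsto, k1_of_withoutTendsto⟩

end Summit.Ventures.CertifiedManyBodySolver.Cruxes.ThermalStiffnessCeilingU8b10_le_1o8.TendstoDeciderL3

end
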